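import Summits.HodgeConjecture.HodgeConjecture.Theorems.MarkmanPartnerTransportPicardThreeK3SquaresKugaSatakeSelfClassMap
import Summits.HodgeConjecture.HodgeConjecture.Theorems.MarkmanPartnerTransportPicardThreeK3SquaresKugaSatakeSelfTranspose

/-!
# Route MarkmanPartnerTransport · crux `PicardThreeK3Squares` (stmt-HodgeConjecture-19652) —
# programme «KS-PAIR», step 2: the Kuga–Satake predicates of TWO surfaces, instantiated at a
# presentation and at its transport, give two algebraic correspondences into ONE Kuga–Satake square,
# and the Lefschetz–transpose on that square

Gen 14's `KugaSatakeSelf.exists_two_correspondences_of_kugaSatake` instantiates the Kuga–Satake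
predicate of ONE surface `S` at two presentations `(T, P, ε, j)`, `(T, d·P, ε, j ∘ g)` of its
transcendental part. For Varesco's theorem on two surfaces (Math. Z. 305 (2023), Thm. 5.3) the second
presentation lives on the OTHER surface: `(T, d·P, ε', j')` with `j' : T → H²_B(S')` (file
`…KugaSatakePairPresentation`: `j' = ι_{T'} ∘ ψ_T` for the restriction `ψ_T` of the similitude). The
Kuga–Satake data `(e₁, e₂, κ_C; A, B, θ)` transport along the identity similarity `(T, Q) → (T, dQ)`
exactly as before (`…KugaSatakeSelfClassMap` §3), so:

* `exists_two_correspondences_of_kugaSatake₂` — **for smooth projective surfaces `S`, `S'` whose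
  Kuga–Satake correspondences are algebraic (`IsKSCorrespondenceAlgebraicBetti`, HYPOTHESES), a
  presentation `(T, H, P, ε, j)` of the transcendental part of `S` with `H` of K3 type and a presentation
  `(T, H, d·P, ε', j')` of that of `S'` (`d > 0`), there are a complex abelian variety `A`, an INJECTIVE
  `μ : T → H²((A × A)(ℂ); ℚ)` and maps `O₁ : H²(S(ℂ); ℂ) → H²((A × A)(ℂ); ℂ)`,
  `O₂ : H²(S'(ℂ); ℂ) → H²((A × A)(ℂ); ℂ)` INDUCED BY ALGEBRAIC CYCLES with `O₁(j t ⊗ 1) = μ t ⊗ 1` and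
  `O₂(j' t ⊗ 1) = μ t ⊗ 1`** (Varesco's "`ψ` induces an isomorphism `KS(S) ≃ KS(S')`", §4);
* `exists_lefschetzTranspose₂` — **the Lefschetz–transpose `R = ᵗO₂ ∘ L_η^{n-2} : H²(Y) → H²(S')`**
  (`Y = A × A`): `R ∘ O₁ : H²(S) → H²(S')` and `R ∘ O₂ : H²(S') → H²(S')` are induced by algebraic
  cycles, and `(R ∘ O₂) σ' ≠ 0` whenever `O₂ σ'` is a non-zero `(2,0)`-class with `O₂ σ̄' = \overline{O₂ σ'}`
  (Hodge–Riemann on `Y`, gen 14's `cupPairing_conj_lefschetzPow_ne_zero`).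

THEOREMS ONLY (existence statements; no definition, no named fact, no sorry); CONDITIONAL on the
Kuga–Satake hypotheses where stated; credits nothing to the Hodge conjecture. Prover seat
hodge-nonav-19652-p1 (gen 15), `--supports stmt-HodgeConjecture-19652`.

References: M. Varesco, Math. Z. 305 (2023), §4 (proof of Thm. 4.5), Prop. 3.1, Lemma 3.3, Lemma 4.4;
S. Floccari, Geom. Topol. 30 (2026) §3.3 Rem. 3.4; B. van Geemen, *Kuga-Satake varieties and the Hodge
conjecture* (2000), §6.3, §10.2; C. Voisin, *Hodge Theory I*, Thm. 6.32; W. Fulton, *Intersection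
Theory*, §16.1.
-/

set_option linter.dupNamespace false

noncomputable section

namespace Summit.HodgeConjecture.HodgeConjecture.Theorems.MarkmanPartnerTransport.KugaSatakePair

open scoped TensorProduct
open CategoryTheory MonoidalCategory Literature.AlgebraicGeometry Literature.AlgebraicGeometry.Motives
open Literature.AlgebraicGeometry.HodgeTheory Literature.AlgebraicTopology.SingularHomology
open Literature.AlgebraicGeometry.Motives.HodgeStructure
open Literature.AlgebraicGeometry.Motives.HodgeStructure.KugaSatake
open Literature.AlgebraicGeometry.Surfaces
open Literature.Geometry.Kaehler (lefschetzPow)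
open Summit.HodgeConjecture.HodgeConjecture.Ring2.AbelianAll
open Summit.HodgeConjecture.HodgeConjecture.Theorems.MarkmanPartnerTransport.KugaSatakeSelf

/-! ### §1 The two correspondences of a pair of presentations -/

/-- **THE TWO ALGEBRAIC CORRESPONDENCES OF A TRANSPORTED PRESENTATION, GRANTED KUGA–SATAKE FOR BOTH
SURFACES.** Let `S`, `S'` be smooth projective surfaces whose Kuga–Satake correspondences are algebraic
(`IsKSCorrespondenceAlgebraicBetti`, HYPOTHESES), `(T, H, P, ε, j)` a presentation of the transcendental
part of `S` with `H` of K3 type, and `(T, H, d·P, ε', j')` (`d > 0`) a presentation of the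
transcendental part of `S'` on the same abstract Hodge structure. Then for some complex abelian variety
`A` (a Kuga–Satake variety of `(T, H, P)`), some INJECTIVE `μ : T → H²((A × A)(ℂ); ℚ)` (the Kuga–Satake
class map) and maps `O₁ : H²(S(ℂ); ℂ) → H²((A × A)(ℂ); ℂ)`, `O₂ : H²(S'(ℂ); ℂ) → H²((A × A)(ℂ); ℂ)`
INDUCED BY ALGEBRAIC CYCLES on `(A × A) × S`, `(A × A) × S'`: `O₁(j t ⊗ 1) = μ t ⊗ 1` and
`O₂(j' t ⊗ 1) = μ t ⊗ 1` for all `t ∈ T` — the two predicates instantiated at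
`(T, H, P, ε, j; e₁, e₂, κ_C; A, B, θ)` and `(T, H, d·P, ε', j'; d⁻¹e₁, e₂, (φ ⊗ φ)κ_C; A, B, φθ)`, whose
Kuga–Satake class maps coincide (`kugaSatakeClassMapBetti_transport`).
[cite: Varesco2023, §4 (proof of Thm. 4.5), Prop. 3.1 and Lemma 3.3] [cite: Floccari2026, §3.3 Rem. 3.4]
[cite: vanGeemen2000KugaSatakeHC, §10.2] -/
theorem exists_two_correspondences_of_kugaSatake₂ {S S' : SchemeOver ℂ} (hS : IsSmoothProjective 2 S)
    (hS' : IsSmoothProjective 2 S')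
    (hKS : IsKSCorrespondenceAlgebraicBetti hS) (hKS' : IsKSCorrespondenceAlgebraicBetti hS')
    {M : HodgeModel 2 S} {hM : M.IsHodgeSymmetric} {M' : HodgeModel 2 S'} {hM' : M'.IsHodgeSymmetric}
    {T : Type} [AddCommGroup T] [Module ℚ T] {H : HodgeStructure T 2} {P : H.Polarization} {ε ε' : ℤˣ}
    {j : H.Hom (bettiTwoHodgeStructure hS M hM)} (hj : IsTranscendentalPartBetti hS M hM H P ε j)
    (hK3 : H.IsOfK3Type) {d : ℚ} (hd : 0 < d)
    {j' : H.Hom (bettiTwoHodgeStructure hS' M' hM')}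
    (hj' : IsTranscendentalPartBetti hS' M' hM' H (P.smul d hd) ε' j') :
    ∃ (A : AbelianVariety ℂ) (μ : T →ₗ[ℚ] bettiCohomology (A.X ⊗ A.X) 2)
      (O₁ : complexBetti S (2 * 1) →ₗ[ℂ] complexBetti (A.X ⊗ A.X) 2)
      (O₂ : complexBetti S' (2 * 1) →ₗ[ℂ] complexBetti (A.X ⊗ A.X) 2),
      Function.Injective μ ∧
      IsAlgebraicCorrespondence (A.dim + A.dim) 2 (A.X ⊗ A.X) S O₁ ∧
      IsAlgebraicCorrespondence (A.dim + A.dim) 2 (A.X ⊗ A.X) S' O₂ ∧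
      (∀ t : T, O₁ (ofRatClass (Motives.ComplexPoints S) (2 * 1) (j.toLinearMap t)) =
        ofRatClass (Motives.ComplexPoints (A.X ⊗ A.X)) 2 (μ t)) ∧
      (∀ t : T, O₂ (ofRatClass (Motives.ComplexPoints S') (2 * 1) (j'.toLinearMap t)) =
        ofRatClass (Motives.ComplexPoints (A.X ⊗ A.X)) 2 (μ t)) := by
  haveI : Module.Finite ℚ T := finite_of_isTranscendentalPartBetti hj
  have hT : H.hodgeNumber 2 0 = 1 := hK3.1
  -- van Geemen's data for `(T, H, P)`
  obtain ⟨e₁, e₂, h12, h1, h2⟩ := P.exists_orthogonal_pair_form_self_neg H hK3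
  obtain ⟨κ, hκ⟩ := exists_isTensorEmbedding P hK3 h12 h1 h2
  obtain ⟨A, B, hB, θ, hθ⟩ := exists_isKugaSatakeVarietyBetti_of_isTranscendentalPartBetti' hj hT
  -- first instantiation: the predicate of `S`
  obtain ⟨O₁, hO₁, hO₁j⟩ := hKS M hM T H P hT ε j hj e₁ e₂ h12 h1 h2 κ hκ A B hB θ hθ
  -- second instantiation: the predicate of `S'`, at the transported data
  obtain ⟨h12', h1', h2'⟩ := smul_pair_conditions P hd h12 h1 h2
  obtain ⟨O₂, hO₂, hO₂j⟩ := hKS' M' hM' T H (P.smul d hd) hT ε' j' hj' (d⁻¹ • e₁) e₂ h12' h1' h2' _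
    (isTensorEmbedding_transport P hd hκ) A B hB _ (isKugaSatakeVarietyBetti_transport P hd hT hθ)
  refine ⟨A, kugaSatakeClassMapBetti H P θ κ, O₁, O₂,
    kugaSatakeClassMapBetti_injective P A θ (isTensorEmbedding_injective P h1.ne hκ), hO₁, hO₂, hO₁j,
    fun t => ?_⟩
  rw [← kugaSatakeClassMapBetti_transport P hd θ κ t]
  exact hO₂j t

/-! ### §2 The Lefschetz–transpose on the common Kuga–Satake square -/

/-- **THE LEFSCHETZ–TRANSPOSE FOR A PAIR.** Let `S`, `S'` be smooth projective surfaces, `Y` smooth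
projective of dimension `n ≥ 2`, and `O₁ : H²(S(ℂ); ℂ) → H²(Y(ℂ); ℂ)`, `O₂ : H²(S'(ℂ); ℂ) → H²(Y(ℂ); ℂ)`
induced by algebraic cycles. Then there is ONE `ℂ`-linear `R : H²(Y(ℂ); ℂ) → H²(S'(ℂ); ℂ)` (namely
`ᵗO₂ ∘ L_η^{n-2}` for a rational Kähler class `η` of `Y`) such that `R ∘ O₁ : H²(S) → H²(S')` and
`R ∘ O₂ : H²(S') → H²(S')` are INDUCED BY ALGEBRAIC CYCLES (on `S' × S`, `S' × S'`), and
`(R ∘ O₂) σ' ≠ 0` for every `σ' ∈ H²(S'(ℂ); ℂ)` whose image `O₂ σ'` is a non-zero `(2,0)`-class with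
`O₂ σ̄' = \overline{O₂ σ'}` (Hodge–Riemann on `Y` + the adjunction `⟨O₂ x, w⟩_Y = ⟨ᵗO₂ w, x⟩_{S'}`).
[cite: Varesco2023, Lemma 4.4 and Thm. 4.5] [cite: VoisinHodgeI2002, §6.3.2 Thm. 6.32] [cite: Fulton1998, §16.1] -/
theorem exists_lefschetzTranspose₂ {S S' Y : SchemeOver ℂ} {n : ℕ} (hS : IsSmoothProjective 2 S)
    (hS' : IsSmoothProjective 2 S') (hY : IsSmoothProjective n Y) (hn : 2 ≤ n)
    {O₁ : complexBetti S (2 * 1) →ₗ[ℂ] complexBetti Y 2} {O₂ : complexBetti S' (2 * 1) →ₗ[ℂ] complexBetti Y 2}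
    (hO₁ : IsAlgebraicCorrespondence n 2 Y S O₁) (hO₂ : IsAlgebraicCorrespondence n 2 Y S' O₂) :
    ∃ R : complexBetti Y 2 →ₗ[ℂ] complexBetti S' (2 * 1),
      IsAlgebraicCorrespondence 2 2 S' S (R ∘ₗ O₁) ∧ IsAlgebraicCorrespondence 2 2 S' S' (R ∘ₗ O₂) ∧
      ∀ σ' : complexBetti S' (2 * 1), IsOfHodgeType n Y 2 2 0 (O₂ σ') → O₂ σ' ≠ 0 →
        O₂ (conjClass _ (2 * 1) σ') = conjClass _ 2 (O₂ σ') → (R ∘ₗ O₂) σ' ≠ 0 := by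
  obtain ⟨r, hr⟩ : ∃ r, 2 + r = n := ⟨n - 2, by omega⟩
  obtain ⟨D⟩ := nonempty_kaehlerRationalDatum hY
  -- the rational Kähler class is algebraic (Lefschetz `(1,1)`)
  have hη : D.Hη ∈ algebraicClasses Y 1 :=
    lefschetzOneOne_rational_holds hY _ D.isRationalClass_Hη D.isOfHodgeType_Hη
  -- the transpose of `O₂`
  have ha : 2 * 1 + 2 * 1 = 2 * 2 := rfl
  have hb : 2 + (2 + 2 * r) = 2 * n := by omega
  obtain ⟨Tt, hTt, hadj⟩ := IsAlgebraicCorrespondence.exists_transpose hY hS' ha hb hO₂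
  -- `R := ᵗO₂ ∘ L^r`
  have hR : IsAlgebraicCorrespondence 2 n S' Y (Tt ∘ₗ lefschetzPow D.Hη r 2) :=
    IsAlgebraicCorrespondence.comp_lefschetzPow hS' hY hη 2 r hTt
  refine ⟨Tt ∘ₗ lefschetzPow D.Hη r 2,
    IsAlgebraicCorrespondence.comp hS' hY hS hO₁ hR (by omega),
    IsAlgebraicCorrespondence.comp hS' hY hS' hO₂ hR (by omega), fun σ hσ hσ0 hconj h0 => ?_⟩
  have hHR := cupPairing_conj_lefschetzPow_ne_zero hY D hr hb hσ hσ0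
  apply hHR
  have key := hadj (conjClass _ (2 * 1) σ) (lefschetzPow D.Hη r 2 (O₂ σ))
  have heven : ((-1 : ℂ) ^ (2 * 1 * (2 + 2 * r))) = 1 := Even.neg_one_pow ⟨2 + 2 * r, by ring⟩
  rw [hconj, heven, one_mul] at key
  rw [key]
  have h0' : Tt (lefschetzPow D.Hη r 2 (O₂ σ)) = 0 := by
    rw [LinearMap.comp_apply, LinearMap.comp_apply] at h0
    exact h0
  rw [h0', map_zero, LinearMap.zero_apply]

end Summit.HodgeConjecture.HodgeConjecture.Theorems.MarkmanPartnerTransport.KugaSatakePair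

end
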